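import Summits.CriticalPhenomena.PercolationContinuityZ3.Theorems.PercNearOneGluingNoHeavyLowerTailKnQuestion8CoefficientwiseCoreClassKernelMixHubPathPrep
import Summits.CriticalPhenomena.PercolationContinuityZ3.Theorems.PercNearOneGluingNoHeavyLowerTailKnQuestion8CoefficientwiseCoreClassKernelMixHubCount
import HarnessLib

/-!
# The prefix flip and the path lemma for the gate type `(u,u)` (PATH LEMMA of hub-Kleitman, memo §1.5)

Support file (`--supports stmt-CriticalPhenomena-4575`, closed), prover `prim-cplus-coupling` (gen 51).  No definitions, no notations,
no named facts, no sorries; standard axioms.  Memo `prim-cplus-coupling/A5-COUPLING-gen51.md` §1.5 ('(u,u): flip the first k edges');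
memo-50 §1.4(iii) ('H≼ on a single path is two prefix flips').

Word form as in `…KernelMixHubPathGeneric` (runs `ri`, `ra` by their wall formulas).
* `hubPath_prefixFlip` — THE PREFIX FLIP: if every source (`W ∖ cW`) starts blue with leading blue run `≥ s ≥ 1`, and every red-starting word
  with leading red run `≥ s` is a target (`cW ∖ W`), then `ω ↦ ω ∪ [1, s]` is an injection of sources into targets along hub moves, so
  `#(F ∩ W) ≤ #(F ∩ cW)` for every hub-move-closed family `F` (`hub_card_filter_le_of_moveInjection`).
* `hubPath_uu` — PATH LEMMA for the gate type `(u,u)` (`W = {C_u ∉ 𝒳, C_u(complement) ∈ 𝒴}`), all positions, `ℓ ≥ 1`: thresholds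
  `s = min{i : [0,i] ∈ 𝒳}`, `t = min{i : [0,i] ∈ 𝒴}`; the flip length is `t` if `t ≥ 1`, else `s`.
[cite: KozmaNitzan2024, Questions 8–9 (§5.5 p. 36) (context)]
-/

namespace Summit.CriticalPhenomena.PercolationContinuityZ3.Theorems

open Finset
open scoped symmDiff

namespace Coefficientwise

open Classical in
/-- **The prefix flip** `ω ↦ ω ∪ [1, s]`: sources (blue start, leading blue run `≥ s`) inject into targets (red start, leading red run `≥ s`)
along hub moves; hence `#(F ∩ W) ≤ #(F ∩ cW)`. [folklore] -/
theorem hubPath_prefixFlip (ℓ : ℕ) (hℓ : 1 ≤ ℓ)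
    (D : Finset ℕ → Finset ℕ) (hD : ∀ ω, D ω = (Icc 1 (ℓ - 1)).filter (fun k => ¬ (k ∈ ω ↔ k + 1 ∈ ω)))
    (ri ra : Finset ℕ → ℕ)
    (hri : ∀ ω, ri ω = if 1 ∈ ω then (if h : (D ω).Nonempty then (D ω).min' h else ℓ) else 0)
    (hra : ∀ ω, ra ω = if 1 ∈ ω then 0 else (if h : (D ω).Nonempty then (D ω).min' h else ℓ))
    (s : ℕ) (hs1 : 1 ≤ s) (W cW : Finset ℕ → Prop)
    (hsrc : ∀ ω, ω ⊆ Icc 1 ℓ → W ω → ¬ cW ω → 1 ∉ ω ∧ s ≤ ra ω)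
    (htgt : ∀ ω, ω ⊆ Icc 1 ℓ → 1 ∈ ω → s ≤ ri ω → cW ω ∧ ¬ W ω)
    (F : Finset (Finset ℕ)) (hFsub : ∀ ω ∈ F, ω ⊆ Icc 1 ℓ)
    (hFup : ∀ ω ∈ F, ∀ a b : ℕ, a ≤ b → b ≤ ℓ → (∀ k ∈ ω, a < k) → (∀ k ∈ ω, k ≤ b) →
      ω ∪ Icc 1 a ∪ Icc (b + 1) ℓ ∈ F) :
    (F.filter (fun ω => W ω)).card ≤ (F.filter (fun ω => cW ω)).card := by
  classical
  have hDle := hubPath_walls_le ℓ D hD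
  have hra_le : ∀ ω, ra ω ≤ ℓ := by
    intro ω; rw [hra]
    split_ifs with h1 h
    · exact Nat.zero_le _
    · have := hDle ω _ ((D ω).min'_mem h); omega
    · exact le_refl _
  -- sources: blue start, all red edges above s, s ≤ ℓ
  have hsrc' : ∀ ω, ω ⊆ Icc 1 ℓ → W ω → ¬ cW ω → 1 ∉ ω ∧ s ≤ ℓ ∧ ∀ k ∈ ω, s < k := by
    intro ω hω hWω hncW
    obtain ⟨h1, hsa⟩ := hsrc ω hω hWω hncW
    refine ⟨h1, le_trans hsa (hra_le ω), fun k hk => ?_⟩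
    rw [hra, if_neg h1] at hsa
    by_cases hDn : (D ω).Nonempty
    · rw [dif_pos hDn] at hsa
      have := hubPath_lt_of_mem_of_first_blue ℓ D hD ω hω h1 hDn k hk
      omega
    · rw [Finset.not_nonempty_iff_eq_empty] at hDn
      have := hubPath_eq_empty_of_first_blue ℓ D hD ω hω h1 hDn
      rw [this] at hk; simp at hk
  -- the flipped word starts with a red run of length ≥ s
  have hflip : ∀ ω, ω ⊆ Icc 1 ℓ → W ω → ¬ cW ω → s ≤ ri (ω ∪ Icc 1 s ∪ Icc (ℓ + 1) ℓ) := by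
    intro ω hω hWω hncW
    obtain ⟨h1, hsl, hlead⟩ := hsrc' ω hω hWω hncW
    have hsa := (hsrc ω hω hWω hncW).2
    rw [Finset.Icc_eq_empty_of_lt (Nat.lt_succ_self ℓ), Finset.union_empty, hri,
      if_pos (Finset.mem_union_right _ (Finset.mem_Icc.mpr ⟨le_refl _, hs1⟩))]
    split_ifs with hDn
    · by_cases hsn : s ≤ ℓ - 1
      · have hw := walls_prefix_fill ℓ D hD ω s hs1 hsn hlead
        have hmem : (D (ω ∪ Icc 1 s)).min' hDn ∈ D ω ∆ {s} := by
          rw [← hw]; exact (D (ω ∪ Icc 1 s)).min'_mem hDn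
        rw [Finset.mem_symmDiff, Finset.mem_singleton] at hmem
        rcases hmem with ⟨hm, _⟩ | ⟨hm, _⟩
        · have hDn' : (D ω).Nonempty := ⟨_, hm⟩
          rw [hra, if_neg h1, dif_pos hDn'] at hsa
          have := (D ω).min'_le _ hm
          omega
        · omega
      · have hsl' : s = ℓ := by omega
        have hω0 : ω = ∅ := by
          rw [Finset.eq_empty_iff_forall_notMem]
          intro k hk
          have := hlead k hk
          have := (Finset.mem_Icc.mp (hω hk)).2
          omega
        exfalso
        rw [hω0, Finset.empty_union, hsl', (hubPath_walls_const ℓ D hD).2] at hDn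
        exact Finset.not_nonempty_empty hDn
    · exact hsl
  have hWf : F.filter (fun ω => W ω) = F.filter (fun ω => ω ⊆ Icc 1 ℓ ∧ W ω) := by
    ext ω; simp only [Finset.mem_filter]
    exact ⟨fun ⟨hF, hw⟩ => ⟨hF, hFsub ω hF, hw⟩, fun ⟨hF, _, hw⟩ => ⟨hF, hw⟩⟩
  have hcWf : F.filter (fun ω => cW ω) = F.filter (fun ω => ω ⊆ Icc 1 ℓ ∧ cW ω) := by
    ext ω; simp only [Finset.mem_filter]
    exact ⟨fun ⟨hF, hw⟩ => ⟨hF, hFsub ω hF, hw⟩, fun ⟨hF, _, hw⟩ => ⟨hF, hw⟩⟩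
  rw [hWf, hcWf]
  refine hub_card_filter_le_of_moveInjection F (fun ω => ω ⊆ Icc 1 ℓ ∧ W ω) (fun ω => ω ⊆ Icc 1 ℓ ∧ cW ω)
    (fun ω ω' => ω' = ω ∪ Icc 1 s ∪ Icc (ℓ + 1) ℓ ∧ s ≤ ℓ ∧ ∀ k ∈ ω, s < k) ?_
    (fun ω => ω ∪ Icc 1 s ∪ Icc (ℓ + 1) ℓ) ?_ ?_
  · rintro ω hω ω' ⟨rfl, hsl, hlead⟩
    exact hFup ω hω s ℓ hsl (le_refl _) hlead fun k hk => (Finset.mem_Icc.mp (hFsub ω hω hk)).2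
  · rintro ω ⟨hω, hWω⟩ hnc
    have hncW : ¬ cW ω := fun h => hnc ⟨hω, h⟩
    obtain ⟨_, hsl, hlead⟩ := hsrc' ω hω hWω hncW
    have hsub : ω ∪ Icc 1 s ∪ Icc (ℓ + 1) ℓ ⊆ Icc 1 ℓ := by
      refine Finset.union_subset (Finset.union_subset hω (Finset.Icc_subset_Icc_right hsl)) ?_
      rw [Finset.Icc_eq_empty_of_lt (Nat.lt_succ_self ℓ)]; exact Finset.empty_subset _
    have h1' : 1 ∈ ω ∪ Icc 1 s ∪ Icc (ℓ + 1) ℓ :=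
      Finset.mem_union_left _ (Finset.mem_union_right _ (Finset.mem_Icc.mpr ⟨le_refl _, hs1⟩))
    obtain ⟨hc, hnw⟩ := htgt _ hsub h1' (hflip ω hω hWω hncW)
    exact ⟨⟨hsub, hc⟩, fun h => hnw h.2, rfl, hsl, hlead⟩
  · rintro ω ω' ⟨hω, hWω⟩ hnc ⟨hω', hWω'⟩ hnc' h
    have hlead := (hsrc' ω hω hWω (fun h' => hnc ⟨hω, h'⟩)).2.2
    have hlead' := (hsrc' ω' hω' hWω' (fun h' => hnc' ⟨hω', h'⟩)).2.2
    have key : ∀ η : Finset ℕ, (∀ k ∈ η, s < k) → (η ∪ Icc 1 s ∪ Icc (ℓ + 1) ℓ) \ Icc 1 s = η := by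
      intro η hη; ext k
      simp only [Finset.mem_sdiff, Finset.mem_union, Finset.mem_Icc]
      constructor
      · rintro ⟨(hk | hk) | hk, hn⟩
        · exact hk
        · exact absurd hk hn
        · omega
      · intro hk; exact ⟨Or.inl (Or.inl hk), fun h' => by have := hη k hk; omega⟩
    rw [← key ω hlead, ← key ω' hlead', h]

open Classical in
/-- **PATH LEMMA, gate type `(u,u)`** (memo §1.5; memo-50 §1.4(iii)), all positions, `ℓ ≥ 1`. [folklore] -/
theorem hubPath_uu (ℓ : ℕ) (hℓ : 1 ≤ ℓ)
    (X Y : Finset ℕ → Prop) (hXmono : ∀ S T : Finset ℕ, S ⊆ T → X S → X T)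
    (hYmono : ∀ S T : Finset ℕ, S ⊆ T → Y S → Y T)
    (D : Finset ℕ → Finset ℕ) (hD : ∀ ω, D ω = (Icc 1 (ℓ - 1)).filter (fun k => ¬ (k ∈ ω ↔ k + 1 ∈ ω)))
    (ri ra : Finset ℕ → ℕ)
    (hri : ∀ ω, ri ω = if 1 ∈ ω then (if h : (D ω).Nonempty then (D ω).min' h else ℓ) else 0)
    (hra : ∀ ω, ra ω = if 1 ∈ ω then 0 else (if h : (D ω).Nonempty then (D ω).min' h else ℓ))
    (W cW : Finset ℕ → Prop)
    (hW : ∀ ω, W ω ↔ ¬ X (Icc 0 (ri ω)) ∧ Y (Icc 0 (ra ω)))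
    (hcW : ∀ ω, cW ω ↔ ¬ X (Icc 0 (ra ω)) ∧ Y (Icc 0 (ri ω)))
    (F : Finset (Finset ℕ)) (hFsub : ∀ ω ∈ F, ω ⊆ Icc 1 ℓ)
    (hFup : ∀ ω ∈ F, ∀ a b : ℕ, a ≤ b → b ≤ ℓ → (∀ k ∈ ω, a < k) → (∀ k ∈ ω, k ≤ b) →
      ω ∪ Icc 1 a ∪ Icc (b + 1) ℓ ∈ F) :
    (F.filter (fun ω => W ω)).card ≤ (F.filter (fun ω => cW ω)).card := by
  classical
  by_cases hX0 : X (Icc 0 0)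
  · have h0 : F.filter (fun ω => W ω) = ∅ := Finset.filter_eq_empty_iff.mpr fun ω _ hWω =>
      ((hW ω).mp hWω).1 (hXmono _ _ (Finset.Icc_subset_Icc_right (Nat.zero_le _)) hX0)
    rw [h0, Finset.card_empty]; exact Nat.zero_le _
  by_cases hYex : ∃ i, Y (Icc 0 i)
  swap
  · push Not at hYex
    have h0 : F.filter (fun ω => W ω) = ∅ := Finset.filter_eq_empty_iff.mpr fun ω _ hWω =>
      hYex _ ((hW ω).mp hWω).2
    rw [h0, Finset.card_empty]; exact Nat.zero_le _
  obtain ⟨t, ht, htmin⟩ : ∃ t, Y (Icc 0 t) ∧ ∀ i, i < t → ¬ Y (Icc 0 i) :=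
    ⟨Nat.find hYex, Nat.find_spec hYex, fun i hi => Nat.find_min hYex hi⟩
  have hYiff : ∀ i, Y (Icc 0 i) ↔ t ≤ i := by
    intro i; constructor
    · intro h; by_contra hc; exact htmin i (by omega) h
    · intro h; exact hYmono _ _ (Finset.Icc_subset_Icc_right h) ht
  have hra1 : ∀ ω, 1 ≤ ra ω → 1 ∉ ω := by
    intro ω h h1; rw [hra, if_pos h1] at h; omega
  have hra0 : ∀ ω, 1 ∈ ω → ra ω = 0 := by
    intro ω h1; rw [hra, if_pos h1]
  by_cases ht1 : 1 ≤ t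
  · -- flip length t
    refine hubPath_prefixFlip ℓ hℓ D hD ri ra hri hra t ht1 W cW ?_ ?_ F hFsub hFup
    · intro ω _ hWω _
      have hta : t ≤ ra ω := (hYiff _).mp ((hW ω).mp hWω).2
      exact ⟨hra1 ω (le_trans ht1 hta), hta⟩
    · intro ω _ h1 hti
      refine ⟨(hcW ω).mpr ⟨?_, (hYiff _).mpr hti⟩, fun h => ?_⟩
      · rw [hra0 ω h1]; exact hX0
      · have := (hYiff _).mp ((hW ω).mp h).2
        rw [hra0 ω h1] at this; omega
  · -- t = 0: 𝒴 is everything; threshold s on 𝒳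
    have ht0 : t = 0 := by omega
    have hYall : ∀ i, Y (Icc 0 i) := fun i => (hYiff i).mpr (by omega)
    by_cases hXex : ∃ i, X (Icc 0 i)
    swap
    · push Not at hXex
      have h1 : F.filter (fun ω => W ω) = F := Finset.filter_true_of_mem fun ω _ => (hW ω).mpr ⟨hXex _, hYall _⟩
      have h2 : F.filter (fun ω => cW ω) = F := Finset.filter_true_of_mem fun ω _ => (hcW ω).mpr ⟨hXex _, hYall _⟩
      rw [h1, h2]
    obtain ⟨s, hs, hsmin⟩ : ∃ s, X (Icc 0 s) ∧ ∀ i, i < s → ¬ X (Icc 0 i) :=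
      ⟨Nat.find hXex, Nat.find_spec hXex, fun i hi => Nat.find_min hXex hi⟩
    have hs1 : 1 ≤ s := by
      by_contra h; have : s = 0 := by omega
      rw [this] at hs; exact hX0 hs
    have hXiff : ∀ i, X (Icc 0 i) ↔ s ≤ i := by
      intro i; constructor
      · intro h; by_contra hc; exact hsmin i (by omega) h
      · intro h; exact hXmono _ _ (Finset.Icc_subset_Icc_right h) hs
    refine hubPath_prefixFlip ℓ hℓ D hD ri ra hri hra s hs1 W cW ?_ ?_ F hFsub hFup
    · intro ω _ _ hncW
      have hXa : X (Icc 0 (ra ω)) := by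
        by_contra h; exact hncW ((hcW ω).mpr ⟨h, hYall _⟩)
      have hsa : s ≤ ra ω := (hXiff _).mp hXa
      exact ⟨hra1 ω (le_trans hs1 hsa), hsa⟩
    · intro ω _ h1 hsi
      refine ⟨(hcW ω).mpr ⟨?_, hYall _⟩, fun h => ((hW ω).mp h).1 ((hXiff _).mpr hsi)⟩
      rw [hra0 ω h1]; exact hX0

end Coefficientwise

end Summit.CriticalPhenomena.PercolationContinuityZ3.Theorems
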